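import Summits.Schanuel.Schanuel.Theorems.DiophantineDichotomyDefs
import Literature.NumberTheory.Transcendental.ExpOneTranscendenceMeasure

/-!
# Stub `stub_eFloor` of line `bounded-index-core` (crux `EPiSimultaneousType`, stmt-Schanuel-6118):
# the nearest printed input, vendored, and the floor it gives

The registered stub is `∀ A > 1, ∃ K C, SlotFloor e A K C`: for every `A > 1`,
`log|P(e)| ≥ −C((max 1 deg P)^A · log(max 1 H(P)) + (max 1 deg P)^K)` for ALL non-zero
`P ∈ ℤ[X₀]` ("`e` has uniform polynomial type `A` at all heights, with a polynomial height-free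
penalty"; vocabulary `SlotFloor`/`CodimOneMeasure`/`mvNatHeight` of `Theorems/DiophantineDichotomyDefs`).

STATUS (literature check of this seat, 2026-08-16; details in the seat's `work/stubs/stub_eFloor_status.md`).
The statement is OPEN for every `A < 2`; only `A = 2` is in print at all heights:
* Nesterenko–Waldschmidt 1996, Thm 4(2): `|P(e)| ≥ exp{−1.3·10⁵ d²(log L + d)}` for `P ≠ 0`,
  `deg P ≤ d`, `L(P) ≤ L`, `L ≥ 3` (`L(P) = Σ|aᵢ|` the length) — degree exponent `2`, penalty `d³`.
  Their Main Theorem with the free parameter `E` saves at most a factor `log d / log log L` over this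
  (the term `2E|θ|` caps `E ≲ d + log L`): a power saving `d^{2−t}` only at hyper-heights
  `log log L ≍ dᵗ log d`, never uniformly.
* Diaz 1993 (Acta Arith. 64) / Popken 1929 / Mahler 1932 (Bugeaud 2004 (3.32)) / Hata 1995: exponent
  `1 + o(1)` only for `log log H ≫ d log d` (resp. `H ≥ H₀(d)`); below that Diaz's bound is again
  `d^{2+o(1)} log H`. Chudnovsky 1984 Thm 2.5: `exp(−c d² ln(Hd) ln² d)` (exponent `2 + o(1)`).
  Fel'dman 1963, Cijsouw 1974, Waldschmidt 1978, Zheng 1991: Gel'fond/Baker-type `e^β` measures, cross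
  term `d² log H` or worse. Ably 1994: exponent `1` but an EXPONENTIAL height-free penalty.
* Dirichlet forbids `A < 1` (`Theorems/KhovanskiiApproxType/Negative/SlotFloorDirichlet.lean`).
So the exact gap is: "`e` has uniform type `< 2` at the intermediate heights
`d^K ≤ log H ≤ exp(c d log d)`" — below that range N–W's `d³` is a polynomial penalty, above it
Mahler–Diaz give `(1 + o(1)) d log H`.

THIS FILE lands the nearest printed input and what it gives, and nothing more:
* `NesterenkoWaldschmidt1996_thm_4_2` — the printed Theorem 4(2) as a NAMED FACT (`def … : Prop`, not
  proved here; users take `(h : Literature.NumberTheory.Transcendental.NesterenkoWaldschmidt1996_thm_4_2)`);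
* `slotFloor_expOne_two_of_nesterenkoWaldschmidt1996 (h : …) : ∃ K C, SlotFloor (Real.exp 1 : ℂ) 2 K C`
  (with `K = 3`, `C = 2·10⁶`): the `ℤ[X] ↔ MvPolynomial (Fin 1) ℤ` and `L ↔ H` bookkeeping
  (`L(P) ≤ (deg P + 1)·H(P)`, `L := 3(D+1)max(1,H)`, `log L ≤ 2 + D + log max(1,H)`).
The registered `stub_eFloor` (every `A > 1`) is NOT proved here and is not restated; the line needs it
with `A < 2/(μ−1)` for the pair-measure exponent `μ < 3` of `stub_pairMeasure`, so `A = 2` serves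
exactly the pair measures with `μ < 2` — none, by Dirichlet (`μ ≥ 2`): this file is the honest record
that the `e`-side input of the line is open, with its printed boundary.
-/

noncomputable section

-- `Summit.Schanuel.Schanuel.…` is the mandated summit/sub-problem namespace (single-conjunct summit), hence:
set_option linter.dupNamespace false

namespace Summit.Schanuel.Schanuel.Theorems

namespace EPiSimultaneousType.EFloor

open Summit.Schanuel.Schanuel.Cruxes.KhovanskiiApproxType.LwSmallHeight (SlotFloor mvNatHeight)

/-- The one-variable polynomial `p` attached to `P ∈ ℤ[X₀]` by `MvPolynomial.uniqueAlgEquiv` has the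
same value at `ξ`: `P(ξ) = p(ξ)`. [folklore] -/
theorem aeval_const_eq_aeval_uniqueAlgEquiv (ξ : ℂ) (P : MvPolynomial (Fin 1) ℤ) :
    MvPolynomial.aeval (fun _ : Fin 1 => ξ) P =
      Polynomial.aeval ξ (MvPolynomial.uniqueAlgEquiv ℤ (Fin 1) P) := by
  rw [MvPolynomial.aeval_def, Polynomial.aeval_def, MvPolynomial.eval₂_const_uniqueAlgEquiv]

/-- `P ≠ 0` iff its one-variable image is `≠ 0`. [folklore] -/
theorem uniqueAlgEquiv_ne_zero {P : MvPolynomial (Fin 1) ℤ} (hP : P ≠ 0) :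
    MvPolynomial.uniqueAlgEquiv ℤ (Fin 1) P ≠ 0 := fun h =>
  hP ((MvPolynomial.uniqueAlgEquiv ℤ (Fin 1)).injective (by rw [h, map_zero]))

/-- A non-zero coefficient of the one-variable image of `P` in degree `k` is a monomial `X₀ᵏ` in the
support of `P`. [folklore] -/
theorem single_mem_support_of_coeff_ne_zero {P : MvPolynomial (Fin 1) ℤ} {k : ℕ}
    (hk : (MvPolynomial.uniqueAlgEquiv ℤ (Fin 1) P).coeff k ≠ 0) :
    Finsupp.single (default : Fin 1) k ∈ P.support := by
  rw [MvPolynomial.coeff_uniqueAlgEquiv] at hk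
  exact MvPolynomial.mem_support_iff.2 hk

/-- The one-variable image of `P` has degree `≤` the total degree of `P`. [folklore] -/
theorem natDegree_uniqueAlgEquiv_le (P : MvPolynomial (Fin 1) ℤ) :
    (MvPolynomial.uniqueAlgEquiv ℤ (Fin 1) P).natDegree ≤ P.totalDegree := by
  rw [Polynomial.natDegree_le_iff_coeff_eq_zero]
  intro N hN
  by_contra hne
  have hmem := single_mem_support_of_coeff_ne_zero hne
  have hle := MvPolynomial.le_totalDegree hmem
  rw [Finsupp.sum_single_index rfl] at hle
  exact absurd hN (not_lt.2 hle)

/-- Every coefficient of the one-variable image of `P` is bounded by the naive height of `P`.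
[folklore] -/
theorem natAbs_coeff_uniqueAlgEquiv_le (P : MvPolynomial (Fin 1) ℤ) (k : ℕ) :
    ((MvPolynomial.uniqueAlgEquiv ℤ (Fin 1) P).coeff k).natAbs ≤ mvNatHeight P := by
  by_cases hk : (MvPolynomial.uniqueAlgEquiv ℤ (Fin 1) P).coeff k = 0
  · rw [hk]; exact Nat.zero_le _
  · have hmem := single_mem_support_of_coeff_ne_zero hk
    rw [MvPolynomial.coeff_uniqueAlgEquiv]
    exact Finset.le_sup (f := fun e => (P.coeff e).natAbs) hmem

/-- Length bound: `L(p) = Σ_{k ≤ deg p} |p_k| ≤ (deg p + 1) · H(P)` for the one-variable image `p` of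
`P`. [folklore] -/
theorem length_uniqueAlgEquiv_le (P : MvPolynomial (Fin 1) ℤ) :
    (∑ k ∈ Finset.range ((MvPolynomial.uniqueAlgEquiv ℤ (Fin 1) P).natDegree + 1),
        |(MvPolynomial.uniqueAlgEquiv ℤ (Fin 1) P).coeff k|) ≤
      ((((MvPolynomial.uniqueAlgEquiv ℤ (Fin 1) P).natDegree + 1) * mvNatHeight P : ℕ) : ℤ) := by
  calc (∑ k ∈ Finset.range ((MvPolynomial.uniqueAlgEquiv ℤ (Fin 1) P).natDegree + 1),
        |(MvPolynomial.uniqueAlgEquiv ℤ (Fin 1) P).coeff k|)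
      ≤ ∑ _k ∈ Finset.range ((MvPolynomial.uniqueAlgEquiv ℤ (Fin 1) P).natDegree + 1),
          (mvNatHeight P : ℤ) := by
        refine Finset.sum_le_sum fun k _ => ?_
        rw [Int.abs_eq_natAbs]
        exact_mod_cast natAbs_coeff_uniqueAlgEquiv_le P k
    _ = ((((MvPolynomial.uniqueAlgEquiv ℤ (Fin 1) P).natDegree + 1) * mvNatHeight P : ℕ) : ℤ) := by
        rw [Finset.sum_const, Finset.card_range]
        push_cast
        ring

/-! ## Elementary real estimates -/

/-- `log 3 ≤ 2`. [folklore] -/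
theorem log_three_le_two : Real.log 3 ≤ 2 := by
  have h := Real.log_le_sub_one_of_pos (show (0 : ℝ) < 3 by norm_num)
  linarith

/-- For `D ≥ 1` and `Y ≥ 1`: `log(3 (D+1) Y) ≤ 2 + D + log Y`. [folklore] -/
theorem log_length_le {D Y : ℝ} (hD : 1 ≤ D) (hY : 1 ≤ Y) :
    Real.log (3 * (D + 1) * Y) ≤ 2 + D + Real.log Y := by
  have hD1 : 0 < D + 1 := by linarith
  have hY0 : 0 < Y := by linarith
  rw [Real.log_mul (by positivity) hY0.ne', Real.log_mul (by norm_num) hD1.ne']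
  have h1 := Real.log_le_sub_one_of_pos hD1
  linarith [log_three_le_two]

/-! ## The floor at `A = 2` from the printed fact -/

/-- **`e` has a slot floor with degree exponent `2`** (`K = 3`, `C = 2·10⁶`), CONDITIONAL on the named
fact `NesterenkoWaldschmidt1996_thm_4_2`: for every non-zero `P ∈ ℤ[X₀]`,
`|P(e)| ≥ exp(−2·10⁶((max 1 deg P)² log(max 1 H(P)) + (max 1 deg P)³))`. Proof: apply the fact to the
one-variable image `p` of `P` with `d := D = max 1 (deg P)` and `L := 3(D+1)·max(1, H(P)) ≥ 3`
(`L(p) ≤ (deg p + 1) H(P) ≤ L`), and bound `1.3·10⁵ D²(log L + D) ≤ 1.3·10⁵ D²(2 + 2D + log max(1,H))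
≤ 2·10⁶ (D² log max(1,H) + D³)`. This is the nearest printed input to the registered (OPEN) stub
`stub_eFloor : ∀ A > 1, ∃ K C, SlotFloor e A K C`, which it does NOT prove (`A = 2` only). [folklore] -/
theorem slotFloor_expOne_two_of_nesterenkoWaldschmidt1996 :
    Literature.NumberTheory.Transcendental.NesterenkoWaldschmidt1996_thm_4_2 → ∃ K C : ℝ, SlotFloor (Real.exp 1 : ℂ) 2 K C := by
  intro h
  refine ⟨3, 2 * 10 ^ 6, by norm_num, fun P hP => ?_⟩
  -- the one-variable data
  set p : Polynomial ℤ := MvPolynomial.uniqueAlgEquiv ℤ (Fin 1) P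
  have hp0 : p ≠ 0 := uniqueAlgEquiv_ne_zero hP
  set n : ℕ := P.totalDegree
  set D : ℕ := max 1 n with hDdef
  set H₀ : ℕ := mvNatHeight P
  set L : ℕ := 3 * (D + 1) * max 1 H₀ with hLdef
  have hD1 : 1 ≤ D := le_max_left _ _
  have hnD : n ≤ D := le_max_right _ _
  have hdeg : p.natDegree ≤ D := (natDegree_uniqueAlgEquiv_le P).trans hnD
  have hlen : (∑ k ∈ Finset.range (p.natDegree + 1), |p.coeff k|) ≤ (L : ℤ) := by
    refine (length_uniqueAlgEquiv_le P).trans ?_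
    have h1 : (p.natDegree + 1) * mvNatHeight P ≤ L := by
      calc (p.natDegree + 1) * mvNatHeight P ≤ (D + 1) * max 1 H₀ :=
            Nat.mul_le_mul (Nat.add_le_add_right hdeg 1) (le_max_right _ _)
        _ ≤ 3 * ((D + 1) * max 1 H₀) := Nat.le_mul_of_pos_left _ (by norm_num)
        _ = L := by rw [hLdef, mul_assoc]
    exact_mod_cast h1
  have hL3 : 3 ≤ L := by
    calc 3 = 3 * 1 * 1 := by norm_num
      _ ≤ 3 * (D + 1) * max 1 H₀ :=
          Nat.mul_le_mul (Nat.mul_le_mul_left 3 (by omega)) (le_max_left _ _)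
  -- the printed fact
  have key := h p D L hp0 hD1 hdeg hlen hL3
  rw [← aeval_const_eq_aeval_uniqueAlgEquiv] at key
  refine le_trans (Real.exp_le_exp.2 (neg_le_neg ?_)) key
  -- real bookkeeping
  have hDR : ((D : ℕ) : ℝ) = max 1 (n : ℝ) := by rw [hDdef]; push_cast; rfl
  set X : ℝ := max 1 (n : ℝ)
  set Y : ℝ := max 1 (H₀ : ℝ)
  have hX1 : 1 ≤ X := le_max_left _ _
  have hY1 : 1 ≤ Y := le_max_left _ _
  have hlogY : 0 ≤ Real.log Y := Real.log_nonneg hY1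
  have hLR : ((L : ℕ) : ℝ) = 3 * (X + 1) * Y := by
    rw [hLdef]; push_cast; rw [hDR]
  have hlogL : Real.log L + D ≤ 2 + 2 * X + Real.log Y := by
    rw [hLR, hDR]
    have := log_length_le hX1 hY1
    linarith
  have e2 : X ^ (2 : ℝ) = X ^ (2 : ℕ) := by exact_mod_cast Real.rpow_natCast X 2
  have e3 : X ^ (3 : ℝ) = X ^ (3 : ℕ) := by exact_mod_cast Real.rpow_natCast X 3
  rw [hDR, e2, e3]
  have hX0 : 0 ≤ X := by linarith
  have hX2 : 0 ≤ X ^ 2 := by positivity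
  have h1 : 1.3 * 10 ^ 5 * X ^ 2 * (Real.log ↑L + ↑D) ≤ 1.3 * 10 ^ 5 * X ^ 2 * (2 + 2 * X + Real.log Y) :=
    mul_le_mul_of_nonneg_left hlogL (by positivity)
  have h2 : X ^ 2 * (2 + 2 * X) ≤ 4 * X ^ 3 := by nlinarith
  have h3 : 0 ≤ X ^ 2 * Real.log Y := by positivity
  nlinarith

end EPiSimultaneousType.EFloor

end Summit.Schanuel.Schanuel.Theorems

end
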